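import Mathlib.GroupTheory.MonoidLocalization.GrothendieckGroup
import Mathlib.Algebra.GroupWithZero.Associated
import Mathlib.Algebra.Group.Submonoid.Basic
import Mathlib.Algebra.Group.Commute.Units
import Mathlib.Algebra.Ring.Divisibility.Basic
import Mathlib.Algebra.Order.Monoid.Canonical.Defs
import Mathlib.Data.PNat.Basic
import Mathlib.Data.NNRat.Defs
import Mathlib.Data.NNReal.Defs
import Mathlib.CategoryTheory.Category.Preorder
import Mathlib.Tactic.Ring
import HarnessLib

/-!
# Frobenioids I, §0: the monoid dictionary (STEP-0 calibration fragment of the abc-iut cell)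

Mochizuki, *The geometry of Frobenioids I: the general theory*, Kyushu J. Math. **62** (2008)
293–400, §0 "Notations and Conventions", paragraphs **Numbers** and **Monoids** (kurims text
pp. 10–12) [cite: MochizukiFrdI2008, §0 pp.10-12]. This is the vocabulary on which Definition 1.1
(divisorial monoids on a category) and hence the definition of a Frobenioid (Def. 1.3) rest.

**Dictionary.** Mochizuki writes his commutative monoids *additively* ("the monoid operation of
`M` will be written additively", p. 11). We render them as Lean `CommMonoid`s written
*multiplicatively*, so that Mathlib's divisibility vocabulary applies verbatim:
`a + b ↦ a * b`, `0 ↦ 1`, `n · a ↦ a ^ n`, `M^± ↦ Mˣ` (`IsUnit`), `M^char = M/M^± ↦ Associates M`,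
`M^gp ↦ Algebra.GrothendieckGroup M`, `a ≤ b ↦ a ∣ b`.

**Contents (every claim printed in the two paragraphs).**
* definitions: torsion-free, sharp, integral, saturated, the perfection `M^pf`, perfect, of
  characteristic type, characteristically injective, `≼`, bounded / `Bound_S(b)`, irreducible,
  primary, primes `Prime(M)`, the submonoid `M_𝔭`, `Λ`-monoprime, `Order(M)`;
* claims proved: `M → M^pf` is injective if `M` is torsion-free, integral and saturated, hence if
  `M` is sharp, integral and saturated; `M^pf` is perfect; `M` is perfect iff `M → M^pf` is
  bijective; `M` is saturated iff `M^char` is; if `M` is of characteristic type then `M` is integral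
  iff `M^char` is; `≼` restricted to `Primary(M)` is an equivalence relation; each prime is closed
  under `n`-th powers; `Primary(M^pf) = {a | ∃ n ≥ 1, a^n ∈ Primary(M)}`;
  `Primary(M) = Primary(M^pf) ∩ M`; `Prime(M) ≃ Prime(M^pf)`; for an `ℝ`-monoprime monoid every
  bounded subset has a unique supremum.

Design: hypotheses (sharp, integral, …) are `Prop`-valued `def`s taken as explicit arguments, not
typeclasses, because the paper switches them on and off per sentence. Deliberately NOT here: the
completion `M ⊗ ℝ_{≥0}` of a `ℚ`-monoprime monoid (p. 10; only used from §2 on), and the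
"Categories" paragraph of §0 (separate file). Nothing here is specific to the abc programme; no
statement of the paper is strengthened.
-/

namespace Literature.AlgebraicGeometry.Frobenioids

open Function

universe u

section Numbers

/-- `N_{≥1}`, the multiplicative monoid of positive integers (FrdI §0 "Numbers", p. 10), is
Mathlib's `ℕ+`; recorded as an abbreviation so that later files can quote the paper's symbol.
[cite: MochizukiFrdI2008, §0 p.10] -/
abbrev NgeOne : Type := ℕ+

end Numbers

variable {M : Type u} [CommMonoid M]

/-! ### The basic predicates (p. 11) -/

section BasicPredicates

variable (M)

/-- `M` is *torsion-free*: `M` has no torsion elements, i.e. `a ^ n = 1` with `n ≥ 1` forces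
`a = 1` (FrdI §0 p. 11, additively `n · a = 0 ⇒ a = 0`). [cite: MochizukiFrdI2008, §0 p.11] -/
@[mk_iff] structure IsTorsionFree : Prop where
  /-- `a ^ n = 1` with `n ≥ 1` forces `a = 1`. -/
  eq_one_of_pow_eq_one : ∀ (a : M) (n : ℕ), 0 < n → a ^ n = 1 → a = 1

/-- `M` is *sharp*: `M^± = 0`, i.e. every invertible element is trivial (FrdI §0 p. 11).
[cite: MochizukiFrdI2008, §0 p.11] -/
@[mk_iff] structure IsSharp : Prop where
  /-- every unit is trivial -/
  eq_one_of_isUnit : ∀ a : M, IsUnit a → a = 1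

/-- `M` is *integral*: the natural map `M → M^gp` to the groupification is injective
(FrdI §0 p. 11). [cite: MochizukiFrdI2008, §0 p.11] -/
@[mk_iff] structure IsIntegral : Prop where
  /-- `M → M^gp` is injective -/
  injective_of : Injective (Algebra.GrothendieckGroup.of (M := M))

/-- `M` is *saturated*: every `a ∈ M^gp` such that `n · a` lies in the image of `M` for some
`n ∈ N_{≥1}` lies in the image of `M` (FrdI §0 p. 11). [cite: MochizukiFrdI2008, §0 p.11] -/
@[mk_iff] structure IsSaturated : Prop where
  /-- if `x ^ n` (`n ≥ 1`) is in the image of `M`, so is `x` -/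
  mem_range_of_pow_mem_range : ∀ (x : Algebra.GrothendieckGroup M) (n : ℕ), 0 < n →
    x ^ n ∈ Set.range (Algebra.GrothendieckGroup.of (M := M)) →
    x ∈ Set.range (Algebra.GrothendieckGroup.of (M := M))

/-- `M` is *perfect*: multiplication by every `n ∈ N_{≥1}` (here: the `n`-th power map) is
bijective on `M` (FrdI §0 p. 11). [cite: MochizukiFrdI2008, §0 p.11] -/
@[mk_iff] structure IsPerfect : Prop where
  /-- every `n`-th power map, `n ≥ 1`, is bijective -/
  bijective_pow : ∀ n : ℕ, 0 < n → Bijective fun a : M => a ^ n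

/-- `M` is *of characteristic type*: the fibres of `M → M^char` are torsors over `M^±`, i.e. the
(always transitive) action of the units on each fibre is free (FrdI §0 p. 11).
[cite: MochizukiFrdI2008, §0 p.11] -/
@[mk_iff] structure IsOfCharType : Prop where
  /-- the unit action on `M` is free -/
  eq_one_of_mul_eq : ∀ (u : Mˣ) (a : M), (u : M) * a = a → u = 1

variable {M}

/-- `M` is integral iff it is cancellative (`M → M^gp` is the localisation at `⊤`; this is the
form in which "integral" of FrdI §0 p. 11 is used). [cite: MochizukiFrdI2008, §0 p.11] -/
theorem isIntegral_iff_isCancelMul : IsIntegral M ↔ IsCancelMul M :=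
  (isIntegral_iff M).trans (Submonoid.LocalizationMap.top_injective_iff _)

/-- A sharp monoid is torsion-free (an element of finite order is a unit) — the "hence, in
particular, if `M` is sharp" of FrdI §0 p. 11. [cite: MochizukiFrdI2008, §0 p.11] -/
theorem IsSharp.isTorsionFree (h : IsSharp M) : IsTorsionFree M :=
  ⟨fun a _n hn han => h.1 a (IsUnit.of_pow_eq_one han hn.ne')⟩

/-- Equality in `M^gp`: `a = b` in `M^gp` iff `c * a = c * b` for some `c ∈ M`. [folklore] -/
private theorem gp_of_eq_of_iff {a b : M} :
    Algebra.GrothendieckGroup.of a = Algebra.GrothendieckGroup.of b ↔ ∃ c : M, c * a = c * b :=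
  ((Localization.monoidOf (⊤ : Submonoid M)).eq_iff_exists).trans
    ⟨fun ⟨c, h⟩ => ⟨c, h⟩, fun ⟨c, h⟩ => ⟨⟨c, Submonoid.mem_top c⟩, h⟩⟩

/-- Every element of `M^gp` is a fraction `a / b` of elements of `M`. [folklore] -/
private theorem gp_exists_eq_div (x : Algebra.GrothendieckGroup M) :
    ∃ a b : M, x = Algebra.GrothendieckGroup.of a / Algebra.GrothendieckGroup.of b := by
  obtain ⟨⟨a, b⟩, h⟩ := (Localization.monoidOf (⊤ : Submonoid M)).surj x
  exact ⟨a, b, eq_div_iff_mul_eq'.mpr h⟩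

end BasicPredicates

/-! ### The perfection `M^pf` (p. 11) -/

section Perfection

variable (M)

/-- The relation defining the perfection as the inductive limit of FrdI §0 p. 11: the pair
`(a, n) : M × N_{≥1}` stands for the element `a` of the copy `I_n` of `M` (informally `a^{1/n}`),
and `(a, n) ∼ (b, m)` iff the two agree in some common later copy, which unwinds to
`∃ N ≥ 1, a^{N m} = b^{N n}`. [cite: MochizukiFrdI2008, §0 p.11] -/
def PerfectionRel (x y : M × ℕ+) : Prop :=
  ∃ N : ℕ+, x.1 ^ ((N : ℕ) * (y.2 : ℕ)) = y.1 ^ ((N : ℕ) * (x.2 : ℕ))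

variable {M}

/-- Exponent bookkeeping: from `a ^ p = b ^ q` to `a ^ (p k) = b ^ (q k)`. [folklore] -/
private theorem pow_eq_pow_mul {a b : M} {p q : ℕ} (h : a ^ p = b ^ q) (k : ℕ) :
    a ^ (p * k) = b ^ (q * k) := by
  rw [pow_mul, pow_mul, h]

/-- `PerfectionRel` is transitive (the index system `(N_{≥1}, ∣)` is directed).
[cite: MochizukiFrdI2008, §0 p.11] -/
theorem PerfectionRel.trans {x y z : M × ℕ+} (h₁ : PerfectionRel M x y) (h₂ : PerfectionRel M y z) :
    PerfectionRel M x z := by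
  obtain ⟨N, h₁⟩ := h₁
  obtain ⟨N', h₂⟩ := h₂
  refine ⟨N * N' * y.2, ?_⟩
  have e₁ := pow_eq_pow_mul h₁ ((N' : ℕ) * (z.2 : ℕ))
  have e₂ := pow_eq_pow_mul h₂ ((N : ℕ) * (x.2 : ℕ))
  rw [show (N' : ℕ) * (z.2 : ℕ) * ((N : ℕ) * (x.2 : ℕ)) = (N : ℕ) * (x.2 : ℕ) * ((N' : ℕ) * (z.2 : ℕ))
    by ring] at e₂
  rw [PNat.mul_coe, PNat.mul_coe,
    show (N : ℕ) * (N' : ℕ) * (y.2 : ℕ) * (z.2 : ℕ) = (N : ℕ) * (y.2 : ℕ) * ((N' : ℕ) * (z.2 : ℕ))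
      by ring,
    show (N : ℕ) * (N' : ℕ) * (y.2 : ℕ) * (x.2 : ℕ) = (N' : ℕ) * (y.2 : ℕ) * ((N : ℕ) * (x.2 : ℕ))
      by ring,
    e₁, e₂]

/-- `PerfectionRel` is an equivalence relation. [cite: MochizukiFrdI2008, §0 p.11] -/
theorem perfectionRel_equivalence : Equivalence (PerfectionRel M) where
  refl _ := ⟨1, rfl⟩
  symm := fun ⟨N, h⟩ => ⟨N, h.symm⟩
  trans := PerfectionRel.trans

/-- Compatibility of `PerfectionRel` with the product `(a, n) · (b, m) = (a^m b^n, n m)`.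
[cite: MochizukiFrdI2008, §0 p.11] -/
theorem PerfectionRel.mul {a a' b b' : M} {n n' m m' : ℕ+} (ha : PerfectionRel M (a, n) (a', n'))
    (hb : PerfectionRel M (b, m) (b', m')) :
    PerfectionRel M (a ^ (m : ℕ) * b ^ (n : ℕ), n * m) (a' ^ (m' : ℕ) * b' ^ (n' : ℕ), n' * m') := by
  obtain ⟨N, ha⟩ := ha
  obtain ⟨N', hb⟩ := hb
  refine ⟨N * N', ?_⟩
  dsimp only at ha hb ⊢
  rw [PNat.mul_coe, PNat.mul_coe, PNat.mul_coe, mul_pow, mul_pow, ← pow_mul, ← pow_mul, ← pow_mul,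
    ← pow_mul]
  have e₁ := pow_eq_pow_mul ha ((N' : ℕ) * (m : ℕ) * (m' : ℕ))
  have e₂ := pow_eq_pow_mul hb ((N : ℕ) * (n : ℕ) * (n' : ℕ))
  rw [show (m : ℕ) * ((N : ℕ) * (N' : ℕ) * ((n' : ℕ) * (m' : ℕ))) = (N : ℕ) * (n' : ℕ) * ((N' : ℕ) * (m : ℕ) * (m' : ℕ)) by ring,
    show (n : ℕ) * ((N : ℕ) * (N' : ℕ) * ((n' : ℕ) * (m' : ℕ))) = (N' : ℕ) * (m' : ℕ) * ((N : ℕ) * (n : ℕ) * (n' : ℕ)) by ring,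
    show (m' : ℕ) * ((N : ℕ) * (N' : ℕ) * ((n : ℕ) * (m : ℕ))) = (N : ℕ) * (n : ℕ) * ((N' : ℕ) * (m : ℕ) * (m' : ℕ)) by ring,
    show (n' : ℕ) * ((N : ℕ) * (N' : ℕ) * ((n : ℕ) * (m : ℕ))) = (N' : ℕ) * (m : ℕ) * ((N : ℕ) * (n : ℕ) * (n' : ℕ)) by ring,
    e₁, e₂]

variable (M)

/-- The setoid of `PerfectionRel`. [cite: MochizukiFrdI2008, §0 p.11] -/
def perfectionSetoid : Setoid (M × ℕ+) := ⟨PerfectionRel M, perfectionRel_equivalence⟩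

/-- The *perfection* `M^pf` of a commutative monoid: the inductive limit of the system
`… → M —(n·)→ M → …` indexed by `(N_{≥1}, ∣)` (FrdI §0 p. 11), realised as a quotient of
`M × N_{≥1}`. [cite: MochizukiFrdI2008, §0 p.11] -/
def Perfection : Type u := Quotient (perfectionSetoid M)

namespace Perfection

variable {M}

/-- The class of `(a, n)` in `M^pf` ("`a^{1/n}`"). [cite: MochizukiFrdI2008, §0 p.11] -/
def mk (a : M) (n : ℕ+) : Perfection M := Quotient.mk (perfectionSetoid M) (a, n)

/-- Equality of classes in `M^pf` unwinds to the defining relation.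
[cite: MochizukiFrdI2008, §0 p.11] -/
theorem mk_eq_mk_iff {a b : M} {n m : ℕ+} :
    mk a n = mk b m ↔ ∃ N : ℕ+, a ^ ((N : ℕ) * (m : ℕ)) = b ^ ((N : ℕ) * (n : ℕ)) :=
  Quotient.eq

/-- Every element of `M^pf` is a class `mk a n`. [cite: MochizukiFrdI2008, §0 p.11] -/
theorem mk_surjective : Surjective (fun x : M × ℕ+ => mk (M := M) x.1 x.2) :=
  Quotient.mk_surjective

/-- Multiplication on `M^pf`: `a^{1/n} · b^{1/m} = (a^m b^n)^{1/(nm)}` (the monoid structure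
induced on the inductive limit, FrdI §0 p. 11). [cite: MochizukiFrdI2008, §0 p.11] -/
instance instMul : Mul (Perfection M) where
  mul := Quotient.map₂ (fun x y : M × ℕ+ => (x.1 ^ (y.2 : ℕ) * y.1 ^ (x.2 : ℕ), x.2 * y.2))
    fun x x' hx y y' hy => PerfectionRel.mul (n := x.2) (n' := x'.2) (m := y.2) (m' := y'.2) hx hy

/-- The unit of `M^pf`. [cite: MochizukiFrdI2008, §0 p.11] -/
instance instOne : One (Perfection M) where
  one := mk 1 1

/-- Computation rule for the product of classes. [cite: MochizukiFrdI2008, §0 p.11] -/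
theorem mk_mul_mk (a b : M) (n m : ℕ+) :
    mk a n * mk b m = mk (a ^ (m : ℕ) * b ^ (n : ℕ)) (n * m) := rfl

/-- `1 = mk 1 1`. [cite: MochizukiFrdI2008, §0 p.11] -/
theorem one_def : (1 : Perfection M) = mk 1 1 := rfl

/-- `mk 1 n = 1` for every index `n`. [cite: MochizukiFrdI2008, §0 p.11] -/
theorem mk_one (n : ℕ+) : mk (1 : M) n = 1 :=
  mk_eq_mk_iff.mpr ⟨1, by rw [one_pow, one_pow]⟩

/-- Rescaling the index: `(a^k)^{1/(nk)} = a^{1/n}`. [cite: MochizukiFrdI2008, §0 p.11] -/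
theorem mk_pow_mul (a : M) (n k : ℕ+) : mk (a ^ (k : ℕ)) (n * k) = mk a n := by
  refine mk_eq_mk_iff.mpr ⟨1, ?_⟩
  rw [← pow_mul, PNat.mul_coe]
  congr 1
  ring

/-- Associativity of the product on `M^pf`. [folklore] -/
private theorem mul_assoc' (x y z : Perfection M) : x * y * z = x * (y * z) := by
  obtain ⟨⟨a, n⟩, rfl⟩ := mk_surjective x
  obtain ⟨⟨b, m⟩, rfl⟩ := mk_surjective y
  obtain ⟨⟨c, p⟩, rfl⟩ := mk_surjective z
  dsimp only
  rw [mk_mul_mk, mk_mul_mk, mk_mul_mk, mk_mul_mk, mul_assoc n m p]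
  congr 1
  rw [PNat.mul_coe, PNat.mul_coe, mul_pow, mul_pow, ← pow_mul, ← pow_mul, ← pow_mul, ← pow_mul,
    mul_assoc, mul_comm (p : ℕ) (n : ℕ), mul_comm (m : ℕ) (n : ℕ)]

/-- Left unit law on `M^pf`. [folklore] -/
private theorem one_mul' (x : Perfection M) : 1 * x = x := by
  obtain ⟨⟨a, n⟩, rfl⟩ := mk_surjective x
  dsimp only
  rw [one_def, mk_mul_mk, one_pow, one_mul, PNat.one_coe, pow_one, one_mul]

/-- Right unit law on `M^pf`. [folklore] -/
private theorem mul_one' (x : Perfection M) : x * 1 = x := by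
  obtain ⟨⟨a, n⟩, rfl⟩ := mk_surjective x
  dsimp only
  rw [one_def, mk_mul_mk, one_pow, mul_one, PNat.one_coe, pow_one, mul_one]

/-- Commutativity of the product on `M^pf`. [folklore] -/
private theorem mul_comm' (x y : Perfection M) : x * y = y * x := by
  obtain ⟨⟨a, n⟩, rfl⟩ := mk_surjective x
  obtain ⟨⟨b, m⟩, rfl⟩ := mk_surjective y
  dsimp only
  rw [mk_mul_mk, mk_mul_mk, mul_comm (a ^ (m : ℕ)), mul_comm n m]

/-- `M^pf` is a commutative monoid (the inductive limit in the category of commutative monoids).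
[cite: MochizukiFrdI2008, §0 p.11] -/
instance instCommMonoid : CommMonoid (Perfection M) where
  mul := (· * ·)
  one := 1
  mul_assoc := mul_assoc'
  one_mul := one_mul'
  mul_one := mul_one'
  mul_comm := mul_comm'

/-- Powers of classes: `(a^{1/n})^k = (a^k)^{1/n}`. [cite: MochizukiFrdI2008, §0 p.11] -/
theorem mk_pow (a : M) (n : ℕ+) (k : ℕ) : mk a n ^ k = mk (a ^ k) n := by
  induction k with
  | zero => rw [pow_zero, pow_zero, mk_one]
  | succ k ih =>
    rw [pow_succ, ih, mk_mul_mk, mk_eq_mk_iff]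
    refine ⟨1, ?_⟩
    simp only [← pow_mul, ← pow_add, PNat.mul_coe, PNat.one_coe, one_mul]
    congr 1
    ring

variable (M)

/-- The natural morphism `M → M^pf` determined by the object `I_1` of the inductive system
(FrdI §0 p. 11): `a ↦ a^{1/1}`. [cite: MochizukiFrdI2008, §0 p.11] -/
def of : M →* Perfection M where
  toFun a := mk a 1
  map_one' := rfl
  map_mul' a b := by
    show mk (a * b) 1 = mk a 1 * mk b 1
    rw [mk_mul_mk, PNat.one_coe, pow_one, pow_one, mul_one]

variable {M}

/-- `of a = mk a 1`. [cite: MochizukiFrdI2008, §0 p.11] -/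
theorem of_apply (a : M) : of M a = mk a 1 := rfl

/-- `(a^{1/n})^n = a` in `M^pf`. [cite: MochizukiFrdI2008, §0 p.11] -/
theorem mk_pow_self (a : M) (n : ℕ+) : mk a n ^ (n : ℕ) = of M a := by
  rw [mk_pow, of_apply, ← mk_pow_mul a 1 n, one_mul]

/-- `of a = of b` iff `a^N = b^N` for some `N ≥ 1`. [cite: MochizukiFrdI2008, §0 p.11] -/
theorem of_eq_of_iff {a b : M} : of M a = of M b ↔ ∃ N : ℕ+, a ^ (N : ℕ) = b ^ (N : ℕ) := by
  rw [of_apply, of_apply, mk_eq_mk_iff]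
  simp only [PNat.one_coe, mul_one]

/-- `mk a n = 1` iff `a^N = 1` for some `N ≥ 1`. [cite: MochizukiFrdI2008, §0 p.11] -/
theorem mk_eq_one_iff {a : M} {n : ℕ+} : mk a n = 1 ↔ ∃ N : ℕ+, a ^ (N : ℕ) = 1 := by
  rw [one_def, mk_eq_mk_iff]
  simp only [PNat.one_coe, mul_one, one_pow]

/-- In a sharp monoid, `mk a n = 1` iff `a = 1`. [cite: MochizukiFrdI2008, §0 p.11] -/
theorem mk_eq_one_iff_of_isSharp (hM : IsSharp M) {a : M} {n : ℕ+} : mk a n = 1 ↔ a = 1 := by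
  rw [mk_eq_one_iff]
  exact ⟨fun ⟨N, hN⟩ => hM.isTorsionFree.1 a N N.pos hN, fun h => ⟨1, by rw [h, one_pow]⟩⟩

end Perfection

variable {M}

/-- "`M^pf` is always perfect" (FrdI §0 p. 11). [cite: MochizukiFrdI2008, §0 p.11] -/
theorem isPerfect_perfection : IsPerfect (Perfection M) := by
  refine ⟨fun k hk => ?_⟩
  constructor
  · intro x y hxy
    obtain ⟨⟨a, n⟩, rfl⟩ := Perfection.mk_surjective x
    obtain ⟨⟨b, m⟩, rfl⟩ := Perfection.mk_surjective y
    dsimp only at hxy ⊢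
    rw [Perfection.mk_pow, Perfection.mk_pow, Perfection.mk_eq_mk_iff] at hxy
    obtain ⟨N, hN⟩ := hxy
    refine Perfection.mk_eq_mk_iff.mpr ⟨N * ⟨k, hk⟩, ?_⟩
    rw [← pow_mul, ← pow_mul] at hN
    rw [PNat.mul_coe, PNat.mk_coe, show (N : ℕ) * k * (m : ℕ) = k * ((N : ℕ) * (m : ℕ)) by ring,
      show (N : ℕ) * k * (n : ℕ) = k * ((N : ℕ) * (n : ℕ)) by ring, hN]
  · intro y
    obtain ⟨⟨b, m⟩, rfl⟩ := Perfection.mk_surjective y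
    refine ⟨Perfection.mk b (m * ⟨k, hk⟩), ?_⟩
    dsimp only
    rw [Perfection.mk_pow]
    exact Perfection.mk_pow_mul b m ⟨k, hk⟩

/-- "`M` is perfect if and only if the natural map `M → M^pf` is an isomorphism"
(FrdI §0 p. 11). [cite: MochizukiFrdI2008, §0 p.11] -/
theorem isPerfect_iff_bijective_of : IsPerfect M ↔ Bijective (Perfection.of M) := by
  constructor
  · intro hP
    constructor
    · intro a b hab
      obtain ⟨N, hN⟩ := Perfection.of_eq_of_iff.mp hab
      exact (hP.1 N N.pos).1 hN
    · intro x
      obtain ⟨⟨a, n⟩, rfl⟩ := Perfection.mk_surjective x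
      obtain ⟨c, hc⟩ := (hP.1 n n.pos).2 a
      dsimp only at hc ⊢
      refine ⟨c, ?_⟩
      rw [Perfection.of_apply, ← hc, ← Perfection.mk_pow_mul c 1 n, one_mul]
  · intro hB
    refine ⟨fun k hk => ⟨fun a b hab => ?_, fun b => ?_⟩⟩
    · dsimp only at hab
      have h : Perfection.of M a ^ k = Perfection.of M b ^ k := by rw [← map_pow, ← map_pow, hab]
      exact hB.1 ((isPerfect_perfection.1 k hk).1 h)
    · obtain ⟨y, hy⟩ := ((isPerfect_perfection (M := M)).1 k hk).2 (Perfection.of M b)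
      obtain ⟨a, rfl⟩ := hB.2 y
      dsimp only at hy
      exact ⟨a, hB.1 (by rw [map_pow, hy])⟩

/-- The natural map `M → M^pf` "is injective if `M` is torsion-free, integral, and saturated"
(FrdI §0 p. 11). [cite: MochizukiFrdI2008, §0 p.11] -/
theorem of_injective_of_isTorsionFree_isIntegral_isSaturated (h₁ : IsTorsionFree M)
    (h₂ : IsIntegral M) (h₃ : IsSaturated M) : Injective (Perfection.of M) := by
  intro a b hab
  obtain ⟨N, hN⟩ := Perfection.of_eq_of_iff.mp hab
  haveI : IsCancelMul M := isIntegral_iff_isCancelMul.mp h₂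
  have hx : (Algebra.GrothendieckGroup.of a / Algebra.GrothendieckGroup.of b) ^ (N : ℕ) ∈
      Set.range (Algebra.GrothendieckGroup.of (M := M)) :=
    ⟨1, by rw [div_pow, ← map_pow, ← map_pow, hN, div_self', map_one]⟩
  obtain ⟨c, hc⟩ := h₃.1 _ N N.pos hx
  have hac : a = c * b := h₂.1 (by rw [map_mul, hc, div_mul_cancel])
  have hcN : c ^ (N : ℕ) = 1 := by
    have : c ^ (N : ℕ) * b ^ (N : ℕ) = 1 * b ^ (N : ℕ) := by rw [← mul_pow, ← hac, hN, one_mul]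
    exact mul_right_cancel this
  rw [hac, h₁.1 c N N.pos hcN, one_mul]

/-- "… hence, in particular, if `M` is sharp, integral, and saturated" (FrdI §0 p. 11).
[cite: MochizukiFrdI2008, §0 p.11] -/
theorem of_injective_of_isSharp_isIntegral_isSaturated (h₁ : IsSharp M) (h₂ : IsIntegral M)
    (h₃ : IsSaturated M) : Injective (Perfection.of M) :=
  of_injective_of_isTorsionFree_isIntegral_isSaturated h₁.isTorsionFree h₂ h₃

end Perfection

/-! ### The characteristic `M^char = M/M^±` (p. 11) -/

section Characteristic

/-- `M^char = M/M^±` is always sharp (FrdI §0 p. 11, definition of the characteristic).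
[cite: MochizukiFrdI2008, §0 p.11] -/
theorem isSharp_associates : IsSharp (Associates M) :=
  ⟨fun a ha => (Associates.isUnit_iff_eq_one a).mp ha⟩

/-- Transfer of equalities along `M → M^char`: `mk (c a) = mk (c b)` in `(M^char)^gp` language,
namely `of (mk x) = of (mk y)` iff `c * x * u = c * y` for some `c ∈ M`, `u ∈ M^±`. [folklore] -/
private theorem gp_of_mk_eq_iff {x y : M} :
    Algebra.GrothendieckGroup.of (Associates.mk x) = Algebra.GrothendieckGroup.of (Associates.mk y) ↔
      ∃ (c : M) (u : Mˣ), c * x * u = c * y := by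
  rw [gp_of_eq_of_iff]
  constructor
  · rintro ⟨c, hc⟩
    obtain ⟨c, rfl⟩ := Associates.mk_surjective c
    rw [Associates.mk_mul_mk, Associates.mk_mul_mk, Associates.mk_eq_mk_iff_associated] at hc
    obtain ⟨u, hu⟩ := hc
    exact ⟨c, u, hu⟩
  · rintro ⟨c, u, hu⟩
    refine ⟨Associates.mk c, ?_⟩
    rw [Associates.mk_mul_mk, Associates.mk_mul_mk, Associates.mk_eq_mk_iff_associated]
    exact ⟨u, hu⟩

/-- "Note that `M` is saturated if and only if `M^char` is" (FrdI §0 p. 11).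
[cite: MochizukiFrdI2008, §0 p.11] -/
theorem isSaturated_iff_associates : IsSaturated M ↔ IsSaturated (Associates M) := by
  constructor
  · rintro ⟨hM⟩
    refine ⟨fun y n hn ⟨m₀, hy⟩ => ?_⟩
    obtain ⟨a, b, rfl⟩ := gp_exists_eq_div y
    obtain ⟨a, rfl⟩ := Associates.mk_surjective a
    obtain ⟨b, rfl⟩ := Associates.mk_surjective b
    obtain ⟨m₀, rfl⟩ := Associates.mk_surjective m₀
    rw [div_pow, ← map_pow, ← map_pow, ← Associates.mk_pow, ← Associates.mk_pow, eq_div_iff_mul_eq',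
      ← map_mul, Associates.mk_mul_mk, gp_of_mk_eq_iff] at hy
    obtain ⟨c, u, hcu⟩ := hy
    -- in `M^gp`: `(a/b)^n = m₀ u`
    have hx : (Algebra.GrothendieckGroup.of a / Algebra.GrothendieckGroup.of b) ^ n ∈
        Set.range (Algebra.GrothendieckGroup.of (M := M)) := by
      refine ⟨m₀ * u, ?_⟩
      rw [div_pow, ← map_pow, ← map_pow, eq_div_iff_mul_eq', ← map_mul]
      have hcu' : c * (m₀ * ↑u * b ^ n) = c * a ^ n := by rw [← hcu]; ac_rfl
      have h := congrArg (Algebra.GrothendieckGroup.of (M := M)) hcu'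
      rw [map_mul (Algebra.GrothendieckGroup.of (M := M)) c (m₀ * ↑u * b ^ n),
        map_mul (Algebra.GrothendieckGroup.of (M := M)) c (a ^ n)] at h
      exact mul_left_cancel h
    obtain ⟨m₁, hm₁⟩ := hM _ n hn hx
    rw [eq_div_iff_mul_eq', ← map_mul, gp_of_eq_of_iff] at hm₁
    obtain ⟨c₁, hc₁⟩ := hm₁
    refine ⟨Associates.mk m₁, ?_⟩
    rw [eq_div_iff_mul_eq', ← map_mul, Associates.mk_mul_mk, gp_of_mk_eq_iff]
    exact ⟨c₁, 1, by rw [Units.val_one, mul_one, hc₁]⟩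
  · rintro ⟨hA⟩
    refine ⟨fun x n hn ⟨m₀, hx⟩ => ?_⟩
    obtain ⟨a, b, rfl⟩ := gp_exists_eq_div x
    rw [div_pow, ← map_pow, ← map_pow, eq_div_iff_mul_eq', ← map_mul, gp_of_eq_of_iff] at hx
    obtain ⟨c, hc⟩ := hx
    have hy : (Algebra.GrothendieckGroup.of (Associates.mk a) /
        Algebra.GrothendieckGroup.of (Associates.mk b)) ^ n ∈
          Set.range (Algebra.GrothendieckGroup.of (M := Associates M)) := by
      refine ⟨Associates.mk m₀, ?_⟩
      rw [div_pow, ← map_pow, ← map_pow, ← Associates.mk_pow, ← Associates.mk_pow,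
        eq_div_iff_mul_eq', ← map_mul, Associates.mk_mul_mk, gp_of_mk_eq_iff]
      exact ⟨c, 1, by rw [Units.val_one, mul_one, hc]⟩
    obtain ⟨m₁, hm₁⟩ := hA _ n hn hy
    obtain ⟨m₁, rfl⟩ := Associates.mk_surjective m₁
    rw [eq_div_iff_mul_eq', ← map_mul, Associates.mk_mul_mk, gp_of_mk_eq_iff] at hm₁
    obtain ⟨c₁, u, hcu⟩ := hm₁
    refine ⟨m₁ * u, ?_⟩
    rw [eq_div_iff_mul_eq', ← map_mul, gp_of_eq_of_iff]
    exact ⟨c₁, by rw [← hcu]; ac_rfl⟩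

/-- `M^char` is always integral-iff-cancellative; cancellation in `M` descends to `M^char`.
[folklore] -/
private theorem isCancelMul_associates [IsCancelMul M] : IsCancelMul (Associates M) := by
  haveI : IsLeftCancelMul (Associates M) := ⟨fun x y z h => by
    change x * y = x * z at h
    obtain ⟨c, rfl⟩ := Associates.mk_surjective x
    obtain ⟨a, rfl⟩ := Associates.mk_surjective y
    obtain ⟨b, rfl⟩ := Associates.mk_surjective z
    rw [Associates.mk_mul_mk, Associates.mk_mul_mk, Associates.mk_eq_mk_iff_associated] at h
    obtain ⟨u, hu⟩ := h
    rw [Associates.mk_eq_mk_iff_associated]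
    exact ⟨u, mul_left_cancel (by rw [← mul_assoc, hu])⟩⟩
  exact CommMagma.IsLeftCancelMul.toIsCancelMul _

/-- "If `M` is of characteristic type, then `M` is integral if and only if `M^char` is"
(FrdI §0 p. 11). [cite: MochizukiFrdI2008, §0 p.11] -/
theorem IsOfCharType.isIntegral_iff_associates (h : IsOfCharType M) :
    IsIntegral M ↔ IsIntegral (Associates M) := by
  rw [isIntegral_iff_isCancelMul, isIntegral_iff_isCancelMul]
  constructor
  · intro _
    exact isCancelMul_associates
  · intro hA
    haveI : IsLeftCancelMul M := ⟨fun c a b hab => by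
      change c * a = c * b at hab
      have h' : Associates.mk c * Associates.mk a = Associates.mk c * Associates.mk b := by
        rw [Associates.mk_mul_mk, Associates.mk_mul_mk, hab]
      obtain ⟨u, hu⟩ := Associates.mk_eq_mk_iff_associated.mp (mul_left_cancel h')
      have hu1 : u = 1 := h.1 u (c * a) (by rw [mul_comm, mul_assoc, hu, hab])
      rw [← hu, hu1, Units.val_one, mul_one]⟩
    exact CommMagma.IsLeftCancelMul.toIsCancelMul _

variable {N : Type u} [CommMonoid N]

/-- The map `M^char → N^char` induced by a morphism of monoids (units map to units).
[cite: MochizukiFrdI2008, §0 p.11] -/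
def associatesMap (φ : M →* N) : Associates M →* Associates N where
  toFun := Quotient.map φ fun a b h => by
    obtain ⟨u, hu⟩ := h
    exact ⟨Units.map φ u, by rw [Units.coe_map, ← map_mul, hu]⟩
  map_one' := congrArg Associates.mk (map_one φ)
  map_mul' x y := Quotient.inductionOn₂ x y fun a b => congrArg Associates.mk (map_mul φ a b)

/-- `associatesMap φ (mk a) = mk (φ a)`. [cite: MochizukiFrdI2008, §0 p.11] -/
theorem associatesMap_mk (φ : M →* N) (a : M) :
    associatesMap φ (Associates.mk a) = Associates.mk (φ a) := rfl

/-- A morphism `φ : M₁ → M₂` of monoids is *characteristically injective* if `φ` is injective and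
the induced `M₁^char → M₂^char` is injective (FrdI §0 p. 11). [cite: MochizukiFrdI2008, §0 p.11] -/
def IsCharInjective (φ : M →* N) : Prop := Injective φ ∧ Injective (associatesMap φ)

end Characteristic

/-! ### The order `≤`, `≼`, primary elements and primes (p. 12) -/

section Order

/-- `a ≼ b`: `∃ n ∈ N_{≥1}, a ≤ n · b`, where `a ≤ b` means `∃ c, a + c = b`, i.e. `a ∣ b` in
multiplicative notation (FrdI §0 p. 12; defined there for sharp integral saturated `M`, the
definition makes sense in general). [cite: MochizukiFrdI2008, §0 p.12] -/
def Precsim (a b : M) : Prop := ∃ n : ℕ, 0 < n ∧ a ∣ b ^ n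

@[inherit_doc] scoped infix:50 " ≼ " => Precsim

/-- `≼` is reflexive. [cite: MochizukiFrdI2008, §0 p.12] -/
theorem precsim_refl (a : M) : a ≼ a := ⟨1, one_pos, by rw [pow_one]⟩

/-- `≼` is transitive. [cite: MochizukiFrdI2008, §0 p.12] -/
theorem Precsim.trans {a b c : M} (h₁ : a ≼ b) (h₂ : b ≼ c) : a ≼ c := by
  obtain ⟨n, hn, han⟩ := h₁
  obtain ⟨m, hm, hbm⟩ := h₂
  exact ⟨m * n, Nat.mul_pos hm hn, han.trans (by rw [pow_mul]; exact pow_dvd_pow_of_dvd hbm n)⟩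

/-- `a ∣ b` implies `a ≼ b`. [cite: MochizukiFrdI2008, §0 p.12] -/
theorem Precsim.of_dvd {a b : M} (h : a ∣ b) : a ≼ b := ⟨1, one_pos, by rwa [pow_one]⟩

/-- `a ^ k ≼ a` for every `k ≥ 1`. [cite: MochizukiFrdI2008, §0 p.12] -/
theorem pow_precsim_self (a : M) {k : ℕ} (hk : 0 < k) : a ^ k ≼ a := ⟨k, hk, dvd_rfl⟩

/-- `a ≼ a ^ k` for every `k ≥ 1`. [cite: MochizukiFrdI2008, §0 p.12] -/
theorem precsim_pow_self (a : M) {k : ℕ} (hk : 0 < k) : a ≼ a ^ k :=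
  Precsim.of_dvd (dvd_pow_self a hk.ne')

/-- `≼` is preserved by monoid morphisms (FrdI §0 p. 12). [cite: MochizukiFrdI2008, §0 p.12] -/
theorem Precsim.map {N : Type u} [CommMonoid N] (φ : M →* N) {a b : M} (h : a ≼ b) : φ a ≼ φ b := by
  obtain ⟨n, hn, h⟩ := h
  exact ⟨n, hn, by rw [← map_pow]; exact map_dvd φ h⟩

/-- In a sharp integral (= cancellative) monoid the divisibility preorder `≤` is antisymmetric,
so `(M, ≤)` is a partial order (this is the order underlying the category `Order(M)`, p. 12).
[cite: MochizukiFrdI2008, §0 p.12] -/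
theorem dvd_antisymm_of_isSharp (hM : IsSharp M) [IsCancelMul M] {a b : M} (h₁ : a ∣ b)
    (h₂ : b ∣ a) : a = b := by
  obtain ⟨c, rfl⟩ := h₁
  obtain ⟨d, hd⟩ := h₂
  have hcd : c * d = 1 := by
    have : a * (c * d) = a * 1 := by rw [← mul_assoc, ← hd, mul_one]
    exact mul_left_cancel this
  rw [hM.1 c (IsUnit.of_mul_eq_one d hcd), mul_one]

/-- A subset `S ⊆ M` is *bounded by `b`* if `a ≤ b` for all `a ∈ S` (FrdI §0 p. 12).
[cite: MochizukiFrdI2008, §0 p.12] -/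
def IsBoundedBy (S : Set M) (b : M) : Prop := ∀ a ∈ S, a ∣ b

/-- `Bound_S(b) := {a ∈ S | a ≤ b}`, "the maximal subset of `S` that is bounded by `b`"
(FrdI §0 p. 12). [cite: MochizukiFrdI2008, §0 p.12] -/
def bound (S : Set M) (b : M) : Set M := {a | a ∈ S ∧ a ∣ b}

/-- `Bound_S(b)` is a subset of `S` bounded by `b` and contains every subset of `S` bounded by `b`
(the maximality asserted on p. 12). [cite: MochizukiFrdI2008, §0 p.12] -/
theorem bound_isBoundedBy_and_maximal (S : Set M) (b : M) :
    IsBoundedBy (bound S b) b ∧ bound S b ⊆ S ∧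
      ∀ T : Set M, T ⊆ S → IsBoundedBy T b → T ⊆ bound S b :=
  ⟨fun _ ha => ha.2, fun _ ha => ha.1, fun _ hT hTb _ ha => ⟨hT ha, hTb _ ha⟩⟩

/-- `0 ≠ a ∈ M` is *irreducible* if `a = b + c` implies `b = 0` or `c = 0` (FrdI §0 p. 12;
multiplicatively: `a ≠ 1` and `a = b * c → b = 1 ∨ c = 1`). [cite: MochizukiFrdI2008, §0 p.12] -/
def IsIrreducibleElt (a : M) : Prop := a ≠ 1 ∧ ∀ b c : M, a = b * c → b = 1 ∨ c = 1

/-- In a sharp monoid Mochizuki's irreducibility (FrdI §0 p. 12) is Mathlib's `Irreducible`.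
[cite: MochizukiFrdI2008, §0 p.12] -/
theorem isIrreducibleElt_iff_irreducible (hM : IsSharp M) (a : M) :
    IsIrreducibleElt a ↔ Irreducible a := by
  have hu : ∀ x : M, IsUnit x ↔ x = 1 := fun x => ⟨hM.1 x, fun h => h ▸ isUnit_one⟩
  simp only [IsIrreducibleElt, irreducible_iff, hu]

/-- `0 ≠ a ∈ M` is *primary* if for every `0 ≠ b ≼ a` it holds that `a ≼ b` (FrdI §0 p. 12).
[cite: MochizukiFrdI2008, §0 p.12] -/
def IsPrimary (a : M) : Prop := a ≠ 1 ∧ ∀ b : M, b ≠ 1 → b ≼ a → a ≼ b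

/-- A non-trivial element `x ≼ z` below a primary element `z` is primary (so primality only depends
on the `≼`-equivalence class among non-trivial elements; FrdI §0 p. 12). [cite: MochizukiFrdI2008, §0 p.12] -/
theorem IsPrimary.of_precsim {x z : M} (hz : IsPrimary z) (h₁ : x ≼ z) (hx : x ≠ 1) :
    IsPrimary x :=
  ⟨hx, fun y hy hyx => h₁.trans (hz.2 y hy (hyx.trans h₁))⟩

variable (M) in
/-- `Primary(M)`, the set of primary elements (FrdI §0 p. 12). [cite: MochizukiFrdI2008, §0 p.12] -/
def primaries : Set M := {a | IsPrimary a}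

/-- "One verifies immediately that the relation `a ≼ b` [for `a, b ∈ Primary(M)`] determines an
equivalence relation on `Primary(M)`" (FrdI §0 p. 12). [cite: MochizukiFrdI2008, §0 p.12] -/
theorem precsim_equivalence_on_primaries :
    Equivalence fun a b : primaries M => (a : M) ≼ (b : M) where
  refl a := precsim_refl (a : M)
  symm {a b} h := b.2.2 a a.2.1 h
  trans h₁ h₂ := h₁.trans h₂

variable (M) in
/-- The setoid on `Primary(M)` given by `≼`. [cite: MochizukiFrdI2008, §0 p.12] -/
def primarySetoid : Setoid (primaries M) := ⟨_, precsim_equivalence_on_primaries⟩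

variable (M) in
/-- `Prime(M)`, the set of primes of `M`: `≼`-equivalence classes of primary elements (FrdI §0
p. 12; "this notion of a prime differs from the conventional notion of a prime ideal of `M`").
[cite: MochizukiFrdI2008, §0 p.12] -/
def Primes : Type u := Quotient (primarySetoid M)

/-- The subset `𝔭 ⊆ M` of a prime: the primary elements in the class `𝔭`.
[cite: MochizukiFrdI2008, §0 p.12] -/
def Primes.carrier (𝔭 : Primes M) : Set M :=
  {a | ∃ h : IsPrimary a, Quotient.mk (primarySetoid M) ⟨a, h⟩ = 𝔭}

/-- `M_𝔭 ⊆ M`, the submonoid generated by the elements of the subset `𝔭 ⊆ M`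
(FrdI §0 p. 12). [cite: MochizukiFrdI2008, §0 p.12] -/
def Primes.submonoid (𝔭 : Primes M) : Submonoid M := Submonoid.closure 𝔭.carrier

/-- Powers `a ^ n`, `n ≥ 1`, of a primary element of a sharp monoid are primary (FrdI §0 p. 12:
primes are "closed under multiplication by elements of `N_{≥1}`"). [cite: MochizukiFrdI2008, §0 p.12] -/
theorem IsPrimary.pow (hM : IsSharp M) {a : M} (ha : IsPrimary a) {n : ℕ} (hn : 0 < n) :
    IsPrimary (a ^ n) :=
  ha.of_precsim (pow_precsim_self a hn) fun h => ha.1 (hM.isTorsionFree.1 a n hn h)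

/-- "Each subset `𝔭 ⊆ M` … is closed under multiplication by elements of `N_{≥1}`": powers
`a ^ n`, `n ≥ 1`, of a primary element are primary and `≼`-equivalent to it — here for sharp `M`
(the paper's standing hypothesis on p. 12). [cite: MochizukiFrdI2008, §0 p.12] -/
theorem Primes.pow_mem_carrier (hM : IsSharp M) (𝔭 : Primes M) {a : M} (ha : a ∈ 𝔭.carrier)
    {n : ℕ} (hn : 0 < n) : a ^ n ∈ 𝔭.carrier := by
  obtain ⟨h, rfl⟩ := ha
  exact ⟨h.pow hM hn, Quotient.sound (pow_precsim_self a hn)⟩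

/-- The natural map `M → M^pf` preserves and reflects `≼`. [cite: MochizukiFrdI2008, §0 p.12] -/
theorem Perfection.of_precsim_of_iff {a b : M} : Perfection.of M a ≼ Perfection.of M b ↔ a ≼ b := by
  refine ⟨fun ⟨n, hn, z, hz⟩ => ?_, Precsim.map _⟩
  obtain ⟨⟨c, m⟩, rfl⟩ := Perfection.mk_surjective z
  dsimp only at hz
  rw [← map_pow, Perfection.of_apply, Perfection.of_apply, Perfection.mk_mul_mk, PNat.one_coe, pow_one,
    Perfection.mk_eq_mk_iff] at hz
  obtain ⟨N, hN⟩ := hz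
  rw [one_mul, PNat.one_coe, mul_one, ← pow_mul] at hN
  refine ⟨n * ((N : ℕ) * (m : ℕ)), Nat.mul_pos hn (Nat.mul_pos N.pos m.pos), ?_⟩
  rw [hN, mul_pow, ← pow_mul]
  exact Dvd.dvd.mul_right (dvd_pow_self a (Nat.mul_pos m.pos N.pos).ne') _

/-- Every element `a^{1/k}` of `M^pf` is `≼`-equivalent to the image of `a`.
[cite: MochizukiFrdI2008, §0 p.12] -/
theorem Perfection.mk_precsim_of (a : M) (k : ℕ+) :
    Perfection.mk a k ≼ Perfection.of M a ∧ Perfection.of M a ≼ Perfection.mk a k := by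
  rw [← Perfection.mk_pow_self a k]
  exact ⟨precsim_pow_self _ k.pos, pow_precsim_self _ k.pos⟩

/-- For sharp `M`, `a ∈ M` is primary iff its image in `M^pf` is. [cite: MochizukiFrdI2008, §0 p.12] -/
theorem Perfection.isPrimary_of_iff (hM : IsSharp M) {a : M} :
    IsPrimary (Perfection.of M a) ↔ IsPrimary a := by
  have h1 : ∀ (b : M) (k : ℕ+), Perfection.mk b k ≠ 1 ↔ b ≠ 1 := fun b k =>
    not_congr (Perfection.mk_eq_one_iff_of_isSharp hM)
  constructor
  · rintro ⟨ha1, ha⟩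
    refine ⟨(h1 a 1).mp ha1, fun b hb hba => ?_⟩
    have hb' : Perfection.of M b ≠ 1 := (h1 b 1).mpr hb
    exact Perfection.of_precsim_of_iff.mp (ha _ hb' (Precsim.map _ hba))
  · rintro ⟨ha1, ha⟩
    refine ⟨(h1 a 1).mpr ha1, fun y hy hya => ?_⟩
    obtain ⟨⟨b, k⟩, rfl⟩ := Perfection.mk_surjective y
    dsimp only at hy hya ⊢
    have hb : b ≠ 1 := (h1 b k).mp hy
    have hba : b ≼ a :=
      Perfection.of_precsim_of_iff.mp ((Perfection.mk_precsim_of b k).2.trans hya)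
    exact (Precsim.map (Perfection.of M) (ha b hb hba)).trans (Perfection.mk_precsim_of b k).2

/-- `Primary(M^pf) = {a ∈ M^pf | ∃ n ∈ N_{≥1} such that n · a ∈ Primary(M)}` (FrdI §0 p. 12,
`M` regarded inside `M^pf` via the natural map; `M` sharp). [cite: MochizukiFrdI2008, §0 p.12] -/
theorem primaries_perfection (hM : IsSharp M) :
    primaries (Perfection M) =
      {x | ∃ n : ℕ, 0 < n ∧ x ^ n ∈ Perfection.of M '' primaries M} := by
  ext x
  obtain ⟨⟨a, k⟩, rfl⟩ := Perfection.mk_surjective x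
  dsimp only
  constructor
  · intro hx
    refine ⟨k, k.pos, a, ?_, (Perfection.mk_pow_self a k).symm⟩
    have hx1 : Perfection.mk a k ≠ 1 := hx.1
    have ha1 : Perfection.of M a ≠ 1 := by
      rw [Ne, Perfection.of_apply, Perfection.mk_eq_one_iff_of_isSharp hM]
      exact (not_congr (Perfection.mk_eq_one_iff_of_isSharp hM)).mp hx1
    exact (Perfection.isPrimary_of_iff hM).mp
      (hx.of_precsim (Perfection.mk_precsim_of a k).2 ha1)
  · rintro ⟨n, hn, b, hb, hbx⟩
    have hb' : IsPrimary (Perfection.of M b) := (Perfection.isPrimary_of_iff hM).mpr hb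
    rw [hbx] at hb'
    refine hb'.of_precsim (precsim_pow_self _ hn) fun h => ?_
    exact hb'.1 (by rw [h, one_pow])

/-- `Primary(M) = Primary(M^pf) ∩ M` (FrdI §0 p. 12; `M` sharp). [cite: MochizukiFrdI2008, §0 p.12] -/
theorem primaries_eq_preimage_primaries_perfection (hM : IsSharp M) :
    primaries M = Perfection.of M ⁻¹' primaries (Perfection M) :=
  Set.ext fun _ => (Perfection.isPrimary_of_iff hM).symm

/-- `Prime(M) ⥲ Prime(M^pf)` (FrdI §0 p. 12; `M` sharp): the natural map induces a bijection on
primes. [cite: MochizukiFrdI2008, §0 p.12] -/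
theorem primes_equiv_primes_perfection (hM : IsSharp M) :
    ∃ e : Primes M ≃ Primes (Perfection M),
      ∀ (a : M) (h : IsPrimary a) (h' : IsPrimary (Perfection.of M a)),
        e (Quotient.mk _ ⟨a, h⟩) = Quotient.mk _ ⟨Perfection.of M a, h'⟩ := by
  let f : Primes M → Primes (Perfection M) :=
    Quotient.map (fun a => ⟨Perfection.of M a, (Perfection.isPrimary_of_iff hM).mpr a.2⟩)
      fun a b h => Precsim.map (Perfection.of M) h
  have hf : Bijective f := by
    constructor
    · intro p q hpq
      obtain ⟨a, rfl⟩ := Quotient.mk_surjective p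
      obtain ⟨b, rfl⟩ := Quotient.mk_surjective q
      exact Quotient.sound (Perfection.of_precsim_of_iff.mp (Quotient.exact hpq))
    · intro q
      obtain ⟨⟨x, hx⟩, rfl⟩ := Quotient.mk_surjective q
      obtain ⟨⟨a, k⟩, rfl⟩ := Perfection.mk_surjective x
      have ha1 : Perfection.of M a ≠ 1 := by
        rw [Ne, Perfection.of_apply, Perfection.mk_eq_one_iff_of_isSharp hM]
        exact (not_congr (Perfection.mk_eq_one_iff_of_isSharp hM)).mp hx.1
      have ha : IsPrimary (Perfection.of M a) :=
        hx.of_precsim (Perfection.mk_precsim_of a k).2 ha1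
      refine ⟨Quotient.mk _ ⟨a, (Perfection.isPrimary_of_iff hM).mp ha⟩, ?_⟩
      exact Quotient.sound (Perfection.mk_precsim_of a k).2
  exact ⟨Equiv.ofBijective f hf, fun a h h' => rfl⟩

variable (M) in
/-- `Order(M)`: the category determined by the partially ordered set `(M, ≤)` (FrdI §0 pp. 10,
12) — objects the elements of `M`, a unique morphism `a → b` iff `a ≤ b`; realised as the
preorder category of the divisibility preorder (a partial order when `M` is sharp and integral,
`dvd_antisymm_of_isSharp`). [cite: MochizukiFrdI2008, §0 p.12] -/
def DivOrder : Type u := M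

/-- The divisibility preorder on `Order(M)`. [cite: MochizukiFrdI2008, §0 p.12] -/
instance DivOrder.instPreorder : Preorder (DivOrder M) where
  le a b := Dvd.dvd (α := M) a b
  le_refl a := dvd_refl (α := M) a
  le_trans _ _ _ h₁ h₂ := dvd_trans (α := M) h₁ h₂

/-- `Order(M)` as a (small) category. [cite: MochizukiFrdI2008, §0 p.12] -/
instance DivOrder.instCategory : CategoryTheory.SmallCategory (DivOrder M) :=
  Preorder.smallCategory _

end Order

/-! ### Monoprime monoids (pp. 10, 12) -/

section Monoprime

variable (M)

/-- `M` is `ℤ`-monoprime: isomorphic to the additive monoid `ℤ_{≥0} = ℕ` (FrdI §0 p. 10).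
[cite: MochizukiFrdI2008, §0 p.10] -/
structure IsZMonoprime : Prop where
  /-- an isomorphism with `(ℕ, +)` exists -/
  nonempty_mulEquiv : Nonempty (M ≃* Multiplicative ℕ)

/-- `M` is `ℚ`-monoprime: isomorphic to the additive monoid `ℚ_{≥0}` (FrdI §0 p. 10).
[cite: MochizukiFrdI2008, §0 p.10] -/
structure IsQMonoprime : Prop where
  /-- an isomorphism with `(ℚ_{≥0}, +)` exists -/
  nonempty_mulEquiv : Nonempty (M ≃* Multiplicative NNRat)

/-- `M` is `ℝ`-monoprime: isomorphic to the additive monoid `ℝ_{≥0}` (FrdI §0 p. 10).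
[cite: MochizukiFrdI2008, §0 p.10] -/
structure IsRMonoprime : Prop where
  /-- an isomorphism with `(ℝ_{≥0}, +)` exists -/
  nonempty_mulEquiv : Nonempty (M ≃* Multiplicative NNReal)

/-- `M` is *monoprime* if it is `Λ`-monoprime for some monoid type `Λ ∈ {ℤ, ℚ, ℝ}`
(FrdI §0 p. 10). [cite: MochizukiFrdI2008, §0 p.10] -/
inductive IsMonoprime : Prop
  /-- `ℤ`-monoprime monoids are monoprime -/
  | ofZ (h : IsZMonoprime M) : IsMonoprime
  /-- `ℚ`-monoprime monoids are monoprime -/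
  | ofQ (h : IsQMonoprime M) : IsMonoprime
  /-- `ℝ`-monoprime monoids are monoprime -/
  | ofR (h : IsRMonoprime M) : IsMonoprime

variable {M}

/-- Divisibility in `Multiplicative ℝ_{≥0}` is the order of `ℝ_{≥0}`. [folklore] -/
private theorem multiplicative_nnreal_dvd_iff (x y : Multiplicative NNReal) :
    x ∣ y ↔ Multiplicative.toAdd x ≤ Multiplicative.toAdd y := by
  constructor
  · rintro ⟨c, rfl⟩
    exact le_iff_exists_add.mpr ⟨Multiplicative.toAdd c, toAdd_mul x c⟩
  · intro h
    obtain ⟨c, hc⟩ := le_iff_exists_add.mp h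
    exact ⟨Multiplicative.ofAdd c, Multiplicative.toAdd.injective (by rw [toAdd_mul, toAdd_ofAdd, hc])⟩

/-- "Observe that if `M` is `ℝ`-monoprime, then every bounded subset `S ⊆ M` possesses a unique
supremum `sup(S) ∈ M`, i.e. `S` is bounded by `b` iff `b ≥ sup(S)`" (FrdI §0 p. 12).
[cite: MochizukiFrdI2008, §0 p.12] -/
theorem existsUnique_sup_of_isRMonoprime (hM : IsRMonoprime M) (S : Set M) (b₀ : M)
    (hb₀ : IsBoundedBy S b₀) : ∃! s : M, ∀ b : M, IsBoundedBy S b ↔ s ∣ b := by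
  obtain ⟨⟨e⟩⟩ := hM
  -- transport: `x ∣ y` in `M` iff `e x ≤ e y` in `ℝ_{≥0}`
  have hdvd : ∀ x y : M, x ∣ y ↔ Multiplicative.toAdd (e x) ≤ Multiplicative.toAdd (e y) :=
    fun x y => by rw [← multiplicative_nnreal_dvd_iff, map_dvd_iff]
  let T : Set NNReal := (fun a => Multiplicative.toAdd (e a)) '' S
  have hT : BddAbove T := ⟨Multiplicative.toAdd (e b₀), by
    rintro _ ⟨a, ha, rfl⟩
    exact (hdvd a b₀).mp (hb₀ a ha)⟩
  refine ⟨e.symm (Multiplicative.ofAdd (sSup T)), fun b => ?_, fun s' hs' => ?_⟩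
  · rw [hdvd, MulEquiv.apply_symm_apply, toAdd_ofAdd, csSup_le_iff' hT]
    constructor
    · rintro hb _ ⟨a, ha, rfl⟩
      exact (hdvd a b).mp (hb a ha)
    · intro hb a ha
      exact (hdvd a b).mpr (hb _ ⟨a, ha, rfl⟩)
  · -- uniqueness: two elements with the same multiples coincide (antisymmetry transported)
    have key : ∀ b : M, e.symm (Multiplicative.ofAdd (sSup T)) ∣ b ↔
        ∀ t ∈ T, t ≤ Multiplicative.toAdd (e b) := fun b => by
      rw [hdvd, MulEquiv.apply_symm_apply, toAdd_ofAdd, csSup_le_iff' hT]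
    have hs'' : ∀ b : M, IsBoundedBy S b ↔ s' ∣ b := hs'
    have h₁ : s' ∣ e.symm (Multiplicative.ofAdd (sSup T)) := by
      rw [← hs'']
      intro a ha
      rw [hdvd, MulEquiv.apply_symm_apply, toAdd_ofAdd]
      exact le_csSup hT ⟨a, ha, rfl⟩
    have h₂ : e.symm (Multiplicative.ofAdd (sSup T)) ∣ s' := by
      rw [key]
      rintro _ ⟨a, ha, rfl⟩
      exact (hdvd a s').mp (((hs'' s').mpr dvd_rfl) a ha)
    rw [hdvd] at h₁ h₂
    exact e.injective (Multiplicative.toAdd.injective (le_antisymm h₁ h₂))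

end Monoprime

end Literature.AlgebraicGeometry.Frobenioids
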